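import Mathlib
import HarnessLib
import Summits.HubbardSuperconductivity.HubbardSuperconductivity.Theorems.KLProgrammeKLRegimeSplitEdgeFactsBandJets

/-!
# Route `KLProgramme` — edge facts for the pair masses ACROSS TRANSFERS, XX: the DEEP CONDITION in the pair-class vocabulary —
# `IsPairClassAt L Q (j + m₀)` and `512·(4 + coeffNorm 1 K) ≤ 4^{m₀}` ⟹ `(4 + coeffNorm 1 K)·|p_Q|_𝕋 ≤ Λ_j/16`

Cell gate-hubbard-kl, seat hubbard-kl-k3c1-p1 (g21; child-1 lineage).  The (D2)-deep row (`…TransferModulusComplDeep`) and the transport rows take the DEEP CONDITION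
`(4 + coeffNorm 1 K)·|p_Q|_𝕋 ≤ Λ_j/16` as a hypothesis; the edge-scale count (`…DeepScaleSums.klds_edge_card_le`) uses `512·v ≤ 4^{m₀}`.  THIS FILE is the one-line bridge to
the cascade's vocabulary: a total momentum in the pair class at resolution `j + m₀` (`|p_Q|_𝕋 ≤ 4^{−(j+m₀)}`, `IsPairClassAt`) is DEEP at scale `j` as soon as
`512·(4 + coeffNorm 1 K) ≤ 4^{m₀}` (`Λ_j = 4^{−j}/32`; `coeffNorm 1 K ≤ 16 ⇒ m₀ = 7`).  So in a class that exits at resolution `N`, the scales `j ≤ N − m₀` are deep and the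
last `m₀` are the edge scales.  Pure arithmetic; no definitions; nothing asserts any slot, stub, K3 or SC. [folklore]
-/

noncomputable section

namespace Summit.HubbardSuperconductivity.HubbardSuperconductivity.Theorems.KLRegimeSplit

set_option linter.dupNamespace false -- summit = problem name (single-conjunct summit), D-0017

open Real Finset Literature.MathematicalPhysics.QuantumLattice Literature.Probability.LatticeModels
open Summit.HubbardSuperconductivity.HubbardSuperconductivity.Theorems.KLProgrammeLegKernels

section Deep

variable {L : ℕ} [NeZero L] (K : TrigPolyC4v)

omit [NeZero L] in
/-- **Deep from the pair class**: `IsPairClassAt L Q (j + m₀)`, `512·(4 + coeffNorm 1 K) ≤ 4^{m₀}` ⟹ `(4 + coeffNorm 1 K)·|p_Q|_𝕋 ≤ Λ_j/16`. [folklore] -/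
theorem kldc_deep_of_isPairClassAt {Q : TorusSite 2 L} {j m₀ : ℕ} (h : IsPairClassAt L Q (j + m₀)) (hm₀ : 512 * (4 + K.coeffNorm 1) ≤ (4 : ℝ) ^ m₀) :
    (4 + K.coeffNorm 1) * klTorusNorm L Q ≤ klScale klE0 j / 16 := by
  have hv : 0 ≤ 4 + K.coeffNorm 1 := by have := TrigPolyC4v.coeffNorm_nonneg 1 K; linarith
  have hs : klTorusNorm L Q ≤ ((4 : ℝ) ^ (j + m₀))⁻¹ := klbj_klTorusNorm_le_of_isPairClassAt h
  have h4j : (0 : ℝ) < (4 : ℝ) ^ j := by positivity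
  have h4m : (0 : ℝ) < (4 : ℝ) ^ m₀ := by positivity
  have hΛ : klScale klE0 j = 1 / 32 * ((4 : ℝ) ^ j)⁻¹ := by simp [klScale, klE0]
  rw [hΛ]
  calc (4 + K.coeffNorm 1) * klTorusNorm L Q ≤ (4 + K.coeffNorm 1) * ((4 : ℝ) ^ (j + m₀))⁻¹ := mul_le_mul_of_nonneg_left hs hv
    _ = (4 + K.coeffNorm 1) / ((4 : ℝ) ^ m₀) * ((4 : ℝ) ^ j)⁻¹ := by rw [pow_add]; field_simp
    _ ≤ 1 / 512 * ((4 : ℝ) ^ j)⁻¹ := by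
        refine mul_le_mul_of_nonneg_right ?_ (by positivity)
        rw [div_le_iff₀ h4m]
        linarith
    _ = 1 / 32 * ((4 : ℝ) ^ j)⁻¹ / 16 := by ring

omit [NeZero L] in
/-- **The admissible numeral**: `coeffNorm 1 K ≤ 16` ⟹ `512·(4 + coeffNorm 1 K) ≤ 4^7`, so `m₀ = 7` edge scales suffice. [folklore] -/
theorem kldc_admissible_m₀ (hK : K.coeffNorm 1 ≤ 16) : 512 * (4 + K.coeffNorm 1) ≤ (4 : ℝ) ^ 7 := by
  norm_num
  linarith

end Deep

end Summit.HubbardSuperconductivity.HubbardSuperconductivity.Theorems.KLRegimeSplit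

end
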